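import Literature.AlgebraicGeometry.HodgeTheory.HypersurfaceComplexPoints
import Literature.AlgebraicGeometry.Motives.AlgPointsProductProofs
import Mathlib.AlgebraicGeometry.Morphisms.Separated
import HarnessLib

/-!
# Fibre products over a base `k`-scheme and their `L`-points

For `k`-schemes `X`, `Y`, `S` (`SchemeOver k = Over (Spec k)`) and `k`-morphisms `f : X ⟶ S`,
`g : Y ⟶ S`, the **fibre product `X ×_S Y`** as a `k`-scheme (Hartshorne, *Algebraic Geometry*,
II.3, Thm. 3.3; Görtz–Wedhorn I, (4.8)–(4.10)):

* `pullbackOver f g : SchemeOver k` with projections `pullbackOver.fst`, `pullbackOver.snd`, the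
  universal `pullbackOver.lift` and `pullbackOver.hom_ext` — Mathlib's `pullback f.left g.left` of
  schemes, structured over `k` through `X` (the forgetful functor `Over (Spec k) ⥤ Scheme` creates
  connected limits; we give the elementary construction rather than the abstract one, so that the
  underlying scheme is definitionally `pullback f.left g.left`);
* `pullbackOver.pointsEquiv`: **`(X ×_S Y)(L) ≃ {(P, Q) ∈ X(L) × Y(L) | f(P) = g(Q)}`** for every
  field `L ⊇ k` (universal property on `Spec L`-valued points; Görtz–Wedhorn I, (4.10));
* `pullbackOver.toProd : X ×_S Y ⟶ X ×_k Y` (the monoidal product of `Over (Spec k)`), a **closed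
  immersion when `S` is separated over `k`** (`isClosedImmersion_toProd_left`): it is the base change
  of the diagonal `S → S ×_k S` along `f × g` (Mathlib `pullback_map_diagonal_isPullback`;
  Görtz–Wedhorn I, Prop. 9.3 / Hartshorne II Ex. 4.8-style argument);
* `pullbackOver.isEmbedding_points`: for a Hausdorff topological field `L`, the map
  `(X ×_S Y)(L) → X(L) × Y(L)` is a **topological embedding** in the strong topologies, with image
  the pairs agreeing on `S` (`range_points`) — closed immersions embed `L`-points
  (`AlgPoints.isEmbedding_map_of_isClosedImmersion`, Serre GAGA §2) and `(X ×_k Y)(L) ≃ₜ X(L) × Y(L)`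
  (`AlgPoints.isHomeomorph_prodEquiv_holds`, Conrad, Prop. 2.1).

Used for the complex points of `C ×_J J'` (pull-back of an isogeny to a curve) towards
`Literature.AlgebraicGeometry.Motives.isIso_bettiCohomology_map_abelJacobi`. All statements proved.

## References

* R. Hartshorne, *Algebraic Geometry* (1977), II.3 Thm. 3.3, II.4 Cor. 4.2. [Hartshorne1977]
* U. Görtz, T. Wedhorn, *Algebraic Geometry I*, 2nd ed. (2020), (4.8)–(4.10), Def./Prop. 9.7.
  [GortzWedhorn2020]
* B. Conrad, *Weil and Grothendieck approaches to adelic points* (2012), Prop. 2.1. [ConradAdelicPoints2012]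
-/

noncomputable section

universe u

open CategoryTheory CategoryTheory.Limits AlgebraicGeometry MonoidalCategory Topology

namespace Literature.AlgebraicGeometry.Motives

section Defs

variable {k : Type u} [Field k] {X Y S : SchemeOver k} (f : X ⟶ S) (g : Y ⟶ S)

/-- The **fibre product `X ×_S Y` of `k`-schemes over a `k`-scheme `S`**, as a `k`-scheme: Mathlib's
`pullback f.left g.left`, over `Spec k` through `X` (Hartshorne II.3 Thm. 3.3; Görtz–Wedhorn I
(4.8)). [cite: Hartshorne1977, II.3 Thm. 3.3] -/
abbrev pullbackOver : SchemeOver k :=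
  Over.mk (pullback.fst f.left g.left ≫ X.hom)

namespace pullbackOver

/-- The underlying scheme of `X ×_S Y` is `pullback f.left g.left` (by `rfl`). [folklore] -/
theorem left : (pullbackOver f g).left = pullback f.left g.left := rfl

/-- The structure morphism of `X ×_S Y` is `pr₁ ≫ (X → Spec k)` (by `rfl`). [folklore] -/
theorem hom : (pullbackOver f g).hom = pullback.fst f.left g.left ≫ X.hom := rfl

/-- The first projection `X ×_S Y ⟶ X` over `k`. [cite: Hartshorne1977, II.3 Thm. 3.3] -/
def fst : pullbackOver f g ⟶ X :=
  Over.homMk (pullback.fst f.left g.left) rfl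

/-- The second projection `X ×_S Y ⟶ Y` over `k`. [cite: Hartshorne1977, II.3 Thm. 3.3] -/
def snd : pullbackOver f g ⟶ Y :=
  Over.homMk (pullback.snd f.left g.left) (by
    change pullback.snd f.left g.left ≫ Y.hom = pullback.fst f.left g.left ≫ X.hom
    rw [← Over.w g, ← Over.w f, pullback.condition_assoc])

/-- The first projection on underlying schemes is `pullback.fst`. [folklore] -/
@[simp]
theorem fst_left : (fst f g).left = pullback.fst f.left g.left := rfl

/-- The second projection on underlying schemes is `pullback.snd`. [folklore] -/
@[simp]
theorem snd_left : (snd f g).left = pullback.snd f.left g.left := rfl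

/-- `pr₁ ≫ f = pr₂ ≫ g`. [cite: Hartshorne1977, II.3 Thm. 3.3] -/
@[reassoc]
theorem condition : fst f g ≫ f = snd f g ≫ g :=
  Over.OverMorphism.ext pullback.condition

variable {f g}

/-- The universal morphism `T ⟶ X ×_S Y` of a pair `a : T ⟶ X`, `b : T ⟶ Y` with `a ≫ f = b ≫ g`.
[cite: Hartshorne1977, II.3 Thm. 3.3] -/
def lift {T : SchemeOver k} (a : T ⟶ X) (b : T ⟶ Y) (w : a ≫ f = b ≫ g) : T ⟶ pullbackOver f g :=
  Over.homMk (pullback.lift a.left b.left (by rw [← Over.comp_left, w, Over.comp_left])) (by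
    change pullback.lift _ _ _ ≫ pullback.fst f.left g.left ≫ X.hom = T.hom
    rw [pullback.lift_fst_assoc, Over.w a])

/-- `lift a b w ≫ pr₁ = a`. [cite: Hartshorne1977, II.3 Thm. 3.3] -/
@[reassoc (attr := simp)]
theorem lift_fst {T : SchemeOver k} (a : T ⟶ X) (b : T ⟶ Y) (w : a ≫ f = b ≫ g) :
    lift a b w ≫ fst f g = a :=
  Over.OverMorphism.ext (pullback.lift_fst _ _ _)

/-- `lift a b w ≫ pr₂ = b`. [cite: Hartshorne1977, II.3 Thm. 3.3] -/
@[reassoc (attr := simp)]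
theorem lift_snd {T : SchemeOver k} (a : T ⟶ X) (b : T ⟶ Y) (w : a ≫ f = b ≫ g) :
    lift a b w ≫ snd f g = b :=
  Over.OverMorphism.ext (pullback.lift_snd _ _ _)

/-- Morphisms into `X ×_S Y` are determined by their two components. [cite: Hartshorne1977, II.3 Thm. 3.3] -/
theorem hom_ext {T : SchemeOver k} {u v : T ⟶ pullbackOver f g} (h₁ : u ≫ fst f g = v ≫ fst f g)
    (h₂ : u ≫ snd f g = v ≫ snd f g) : u = v :=
  Over.OverMorphism.ext (pullback.hom_ext (congrArg CommaMorphism.left h₁ :)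
    (congrArg CommaMorphism.left h₂ :))

variable (f g)

/-! ### `L`-points -/

/-- **`(X ×_S Y)(L) ≃ {(P, Q) | f(P) = g(Q)}`**: `L`-points of the fibre product are the pairs of
`L`-points of `X` and `Y` with the same image in `S(L)` (universal property on `Spec L`;
Görtz–Wedhorn I (4.10)). [cite: Hartshorne1977, II.3 Thm. 3.3] -/
def pointsEquiv (L : Type u) [Field L] [Algebra k L] :
    AlgPoints (pullbackOver f g) L ≃
      {p : AlgPoints X L × AlgPoints Y L // AlgPoints.map f p.1 = AlgPoints.map g p.2} where
  toFun P := ⟨(AlgPoints.map (fst f g) P, AlgPoints.map (snd f g) P), by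
    simp only [AlgPoints.map_apply, Category.assoc, condition]⟩
  invFun p := lift p.1.1 p.1.2 p.2
  left_inv P := hom_ext (by simp [AlgPoints.map_apply]) (by simp [AlgPoints.map_apply])
  right_inv p := Subtype.ext (Prod.ext (lift_fst _ _ _) (lift_snd _ _ _))

/-- The first component of `pointsEquiv P` is `pr₁(P)`. [folklore] -/
@[simp]
theorem pointsEquiv_apply_fst (L : Type u) [Field L] [Algebra k L] (P : AlgPoints (pullbackOver f g) L) :
    ((pointsEquiv f g L P).1).1 = AlgPoints.map (fst f g) P := rfl

/-- The second component of `pointsEquiv P` is `pr₂(P)`. [folklore] -/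
@[simp]
theorem pointsEquiv_apply_snd (L : Type u) [Field L] [Algebra k L] (P : AlgPoints (pullbackOver f g) L) :
    ((pointsEquiv f g L P).1).2 = AlgPoints.map (snd f g) P := rfl

/-! ### The closed immersion `X ×_S Y ⟶ X ×_k Y` -/

/-- The canonical monomorphism `X ×_S Y ⟶ X ×_k Y` into the product over `k` (the monoidal product of
`Over (Spec k)`). [cite: Hartshorne1977, II.3 Thm. 3.3] -/
def toProd : pullbackOver f g ⟶ X ⊗ Y :=
  CartesianMonoidalCategory.lift (fst f g) (snd f g)

/-- `toProd ≫ pr₁ = pr₁`. [folklore] -/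
@[reassoc (attr := simp)]
theorem toProd_fst : toProd f g ≫ CartesianMonoidalCategory.fst X Y = fst f g :=
  CartesianMonoidalCategory.lift_fst _ _

/-- `toProd ≫ pr₂ = pr₂`. [folklore] -/
@[reassoc (attr := simp)]
theorem toProd_snd : toProd f g ≫ CartesianMonoidalCategory.snd X Y = snd f g :=
  CartesianMonoidalCategory.lift_snd _ _

/-- On underlying schemes, `X ×_S Y ⟶ X ×_k Y` is the base change of the diagonal of `S → Spec k` along
`f × g` (Mathlib's `pullback.map … S.hom`), followed by the identification
`pullback (f ≫ (S → Spec k)) (g ≫ (S → Spec k)) ≅ pullback (X → Spec k) (Y → Spec k)`. [folklore] -/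
theorem toProd_left :
    (toProd f g).left =
      pullback.map f.left g.left (f.left ≫ S.hom) (g.left ≫ S.hom) (𝟙 _) (𝟙 _) S.hom
          (Category.id_comp _).symm (Category.id_comp _).symm ≫
        (pullback.congrHom (Over.w f) (Over.w g)).hom := by
  apply pullback.hom_ext
  · have h1 : (toProd f g).left ≫ pullback.fst X.hom Y.hom = pullback.fst f.left g.left :=
      congrArg CommaMorphism.left (toProd_fst f g)
    refine h1.trans ?_
    symm
    erw [Category.assoc, pullback.congrHom_hom, pullback.lift_fst, Category.comp_id, pullback.lift_fst,
      Category.comp_id]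
  · have h2 : (toProd f g).left ≫ pullback.snd X.hom Y.hom = pullback.snd f.left g.left :=
      congrArg CommaMorphism.left (toProd_snd f g)
    refine h2.trans ?_
    symm
    erw [Category.assoc, pullback.congrHom_hom, pullback.lift_snd, Category.comp_id, pullback.lift_snd,
      Category.comp_id]

/-- **`X ×_S Y ⟶ X ×_k Y` is a closed immersion when `S` is separated over `k`** (base change of
the closed diagonal `S → S ×_k S`; Hartshorne II.4 Cor. 4.2-style, Görtz–Wedhorn I Prop. 9.7).
[cite: Hartshorne1977, II.4 Cor. 4.2] -/
instance isClosedImmersion_toProd_left [IsSeparated S.hom] : IsClosedImmersion (toProd f g).left := by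
  rw [toProd_left]
  haveI hm : IsClosedImmersion (pullback.map f.left g.left (f.left ≫ S.hom) (g.left ≫ S.hom) (𝟙 _)
      (𝟙 _) S.hom (Category.id_comp _).symm (Category.id_comp _).symm) :=
    MorphismProperty.of_isPullback (P := @IsClosedImmersion)
      (pullback_map_diagonal_isPullback f.left g.left S.hom) inferInstance
  exact @IsClosedImmersion.comp _ _ (pullback X.hom Y.hom) _ (pullback.congrHom (Over.w f) (Over.w g)).hom hm
    inferInstance

end pullbackOver

end Defs

/-! ### The strong topology on `L`-points of a fibre product -/

namespace pullbackOver

variable {k : Type} [Field k] {X Y S : SchemeOver k} (f : X ⟶ S) (g : Y ⟶ S)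
  (L : Type) [Field L] [Algebra k L]

/-- The pair-of-points map of the fibre product factors as `prodEquiv ∘ (toProd)(L)`. [folklore] -/
theorem coe_pointsEquiv_eq (P : AlgPoints (pullbackOver f g) L) :
    ((pointsEquiv f g L P).1 : AlgPoints X L × AlgPoints Y L) =
      AlgPoints.prodEquiv (AlgPoints.map (toProd f g) P) := by
  refine Prod.ext ?_ ?_
  · change AlgPoints.map (fst f g) P = AlgPoints.map (CartesianMonoidalCategory.fst X Y) (AlgPoints.map (toProd f g) P)
    rw [← AlgPoints.map_comp_apply, toProd_fst]
  · change AlgPoints.map (snd f g) P = AlgPoints.map (CartesianMonoidalCategory.snd X Y) (AlgPoints.map (toProd f g) P)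
    rw [← AlgPoints.map_comp_apply, toProd_snd]

/-- **`(X ×_S Y)(L) → X(L) × Y(L)` is a topological embedding** for the strong topologies, `L` a
Hausdorff topological field and `S` separated over `k`: a closed immersion embeds `L`-points
(Serre, GAGA §2; `AlgPoints.isEmbedding_map_of_isClosedImmersion`) and
`(X ×_k Y)(L) ≃ₜ X(L) × Y(L)` (Conrad 2012, Prop. 2.1; `AlgPoints.isHomeomorph_prodEquiv_holds`).
[cite: ConradAdelicPoints2012, Prop. 2.1] -/
theorem isEmbedding_points [TopologicalSpace L] [IsTopologicalDivisionRing L] [T2Space L]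
    [IsSeparated S.hom] :
    IsEmbedding fun P : AlgPoints (pullbackOver f g) L =>
      ((pointsEquiv f g L P).1 : AlgPoints X L × AlgPoints Y L) := by
  have h : (fun P : AlgPoints (pullbackOver f g) L =>
      ((pointsEquiv f g L P).1 : AlgPoints X L × AlgPoints Y L)) =
      AlgPoints.prodEquiv ∘ AlgPoints.map (toProd f g) := funext (coe_pointsEquiv_eq f g L)
  rw [h]
  exact (AlgPoints.isHomeomorph_prodEquiv_holds (X := X) (Y := Y) (L := L)).isEmbedding.comp
    (AlgPoints.isEmbedding_map_of_isClosedImmersion (L := L) (toProd f g))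

/-- The pair-of-points map is continuous. [folklore] -/
theorem continuous_points [TopologicalSpace L] [IsTopologicalDivisionRing L] [T2Space L]
    [IsSeparated S.hom] :
    Continuous fun P : AlgPoints (pullbackOver f g) L =>
      ((pointsEquiv f g L P).1 : AlgPoints X L × AlgPoints Y L) :=
  (isEmbedding_points f g L).continuous

/-- The image of `(X ×_S Y)(L) → X(L) × Y(L)` is the set of pairs agreeing on `S`. [cite: Hartshorne1977, II.3 Thm. 3.3] -/
theorem range_points :
    Set.range (fun P : AlgPoints (pullbackOver f g) L =>
      ((pointsEquiv f g L P).1 : AlgPoints X L × AlgPoints Y L)) =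
      {p | AlgPoints.map f p.1 = AlgPoints.map g p.2} := by
  ext p
  constructor
  · rintro ⟨P, rfl⟩
    exact (pointsEquiv f g L P).2
  · intro hp
    exact ⟨(pointsEquiv f g L).symm ⟨p, hp⟩,
      congrArg Subtype.val ((pointsEquiv f g L).apply_symm_apply ⟨p, hp⟩)⟩

end pullbackOver

end Literature.AlgebraicGeometry.Motives

end
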